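import Mathlib
import Summits.ResolutionOfSingularities.ResolutionOfSingularities.Theorems.RadicialJungCleanModelsCleanProp44CornerPointUnique
import HarnessLib

/-!
# Route `RadicialJung`, crux `CleanModels` (stmt-ResolutionOfSingularities-15917), line `Sketch` rev 35, stub 6 `stub_cleanProp44` (X44c):
# THE CROSS POINT OF A NEAR LINE IS UNIQUE (global count (iv), births)

Seat decomp-res-hand-2 g19 (structural hand); sequel of ✓ `…CleanProp44CornerPointUnique.lean`.  Hand-2 g18's endpoint
✓ `cleanPermissibleAt_nearLine_or_vertex_or_cross` locates the births of the near line `ℓ` of `y = Σ m_k c_k` (uncharged plane, `p ∣ Σ a`) at the points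
`x' ∈ ℓ` through which the strict transform of a CROSS HYPERSURFACE `V(w)`, `w = a_{k₁} m_{k₂} c_{k₂} − a_{k₂} m_{k₁} c_{k₁}`, passes; g18's ✓ `cross_span_eq_iff`
shows that along `ℓ` all cross tests agree.  The COUNT «`ℓ ∩ V(w̄)` is ONE point» needs no `ℙ²`: whenever `(c_k, y, w)` is a regular system of parameters at
`x` for some `k` (i.e. the lines `ȳ = 0` and `w̄ = 0` of `E_x` are distinct), the corner-uniqueness theorem applied to THIS system says that two points over
`x` lying on the strict transforms of `V(y)` (= on the near line) and of `V(w)` coincide.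

* `eq_of_nearLineCross_of_nearLineCross` — two points over `s` through which the strict transforms of `V(y)` and `V(w)` both pass coincide, for any
  `c₀, y, w` with `(c₀, y, w) = 𝔪_s` (✓ `eq_of_twoSides_of_twoSides` for the regular system `(c₀, y, w)`).
* `span_singleton_mul_ne_of_mem_maximalIdeal` — the dictionary «`τ^♯ y = e' · y'` with `y' ∈ 𝔪_{x'}`» ⟹ «the strict transform of `V(y)` passes through
  `x'`» (`(τ^♯ y) ≠ (e') = 𝔪_s 𝒪_{X',x'}`), in a domain.
* Consequence for the (R1ᵐⁱⁿ) prover: on a near line there is at most ONE cross point (per cross form `w` independent of `y`), hence — with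
  ✓ `eq_of_vertexObstruction_of_vertexObstruction` — every near line carries at most one vertex obstruction and at most one birth candidate of each cross
  type; the obstruction set of ✓ `cleanPermissibleAt_nearLine_or_vertex_or_cross` is finite and explicitly bounded.

Honest framing: OURS, bookkeeping.  Nothing here proves X44c, any case of `CleanModels`, or resolution of singularities in characteristic `p`.
Setting only: [cite: CossartPiltant2008, Lemma 4.3 (3), (5); Prop. 4.4 (proof, p. 11)] [cite: StacksProject, Tag 0804].
-/

noncomputable section

set_option linter.dupNamespace false -- mandated namespace of this single-conjunct summit

open IsLocalRing CategoryTheory AlgebraicGeometry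
open Literature.AlgebraicGeometry.Resolution Literature.AlgebraicGeometry.Motives

namespace Summit.ResolutionOfSingularities.ResolutionOfSingularities.Theorems.RadicialJung.CleanModels

universe u

/-- **Dictionary**: in a domain, `τ^♯ y = e' · y'` with `e' ≠ 0` and `y'` a non-unit forces `(τ^♯ y) ≠ (e')` — the strict transform of `V(y)` passes
through the point. [folklore] -/
theorem span_singleton_mul_ne_of_mem_maximalIdeal {R : Type u} [CommRing R] [IsLocalRing R] [IsDomain R] {e' y' : R} (he' : e' ≠ 0)
    (hy' : y' ∈ maximalIdeal R) : Ideal.span {e' * y'} ≠ Ideal.span {e'} := fun h =>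
  (mem_maximalIdeal _).mp hy' (isUnit_of_span_singleton_mul_eq he' h)

section Scheme

variable {X X' : Scheme.{u}} {τ : X' ⟶ X} {J : X.IdealSheafData}

set_option maxHeartbeats 800000 in
-- long statement, one-line proof
/-- **THE CROSS POINT OF A NEAR LINE IS UNIQUE.**  See the module docstring: `(c₀, y, w) = 𝔪_s` a regular system of parameters of the regular threefold point
`s` (`J_s = 𝔪_s`), `y₁, y₂` over `s` through which the strict transforms of `V(y)` AND `V(w)` pass (read through `τ^♯_{y_i} ∘ (𝒪_{X,s} ≅ 𝒪_{X,τ y_i})`);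
then `y₁ = y₂`. [cite: CossartPiltant2008, Lemma 4.3 (3), (5); Prop. 4.4 (proof, p. 11)] [cite: StacksProject, Tag 0804] -/
theorem eq_of_nearLineCross_of_nearLineCross (hτ : IsBlowup τ J) {s : X} (hR : IsRegularLocalRing (X.presheaf.stalk s))
    (hd : (maximalIdeal (X.presheaf.stalk s)).spanFinrank = 3) (hJ : stalkIdeal J s = maximalIdeal (X.presheaf.stalk s))
    {c₀ y w : X.presheaf.stalk s} (hcyw : Ideal.span ({c₀, y, w} : Set (X.presheaf.stalk s)) = maximalIdeal (X.presheaf.stalk s))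
    {y₁ y₂ : X'} (hy₁ : τ y₁ = s) (hy₂ : τ y₂ = s)
    (h₁y : Ideal.span {((τ.stalkMap y₁).hom.comp (X.presheaf.stalkCongr (.of_eq hy₁.symm)).hom.hom) y} ≠
      (maximalIdeal (X.presheaf.stalk s)).map ((τ.stalkMap y₁).hom.comp (X.presheaf.stalkCongr (.of_eq hy₁.symm)).hom.hom))
    (h₁w : Ideal.span {((τ.stalkMap y₁).hom.comp (X.presheaf.stalkCongr (.of_eq hy₁.symm)).hom.hom) w} ≠
      (maximalIdeal (X.presheaf.stalk s)).map ((τ.stalkMap y₁).hom.comp (X.presheaf.stalkCongr (.of_eq hy₁.symm)).hom.hom))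
    (h₂y : Ideal.span {((τ.stalkMap y₂).hom.comp (X.presheaf.stalkCongr (.of_eq hy₂.symm)).hom.hom) y} ≠
      (maximalIdeal (X.presheaf.stalk s)).map ((τ.stalkMap y₂).hom.comp (X.presheaf.stalkCongr (.of_eq hy₂.symm)).hom.hom))
    (h₂w : Ideal.span {((τ.stalkMap y₂).hom.comp (X.presheaf.stalkCongr (.of_eq hy₂.symm)).hom.hom) w} ≠
      (maximalIdeal (X.presheaf.stalk s)).map ((τ.stalkMap y₂).hom.comp (X.presheaf.stalkCongr (.of_eq hy₂.symm)).hom.hom)) :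
    y₁ = y₂ := by
  have hc : Ideal.span (Set.range (![c₀, y, w] : Fin 3 → X.presheaf.stalk s)) = maximalIdeal (X.presheaf.stalk s) := by
    rw [← hcyw]
    congr 1
    ext t
    simp only [Set.mem_range, Set.mem_insert_iff, Set.mem_singleton_iff]
    constructor
    · rintro ⟨j, rfl⟩
      fin_cases j <;> simp
    · rintro (rfl | rfl | rfl)
      exacts [⟨0, rfl⟩, ⟨1, rfl⟩, ⟨2, rfl⟩]
  have hk : (1 : Fin 3) ≠ 2 := by decide
  exact eq_of_twoSides_of_twoSides hτ hR ![c₀, y, w] hc hd (hc.trans hJ.symm) hk hy₁ hy₂ h₁y h₁w h₂y h₂w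

/-- **The cross point is unique, for `x'` and `x''` over the same point** (conditions at `x'` read through `τ^♯_{x'}` directly).
[cite: CossartPiltant2008, Lemma 4.3 (3), (5)] [cite: StacksProject, Tag 0804] -/
theorem eq_of_nearLineCross_of_nearLineCross' (hτ : IsBlowup τ J) {x' x'' : X'} (he : τ x'' = τ x')
    (hR : IsRegularLocalRing (X.presheaf.stalk (τ x'))) (hd : (maximalIdeal (X.presheaf.stalk (τ x'))).spanFinrank = 3)
    (hJ : stalkIdeal J (τ x') = maximalIdeal (X.presheaf.stalk (τ x')))
    {c₀ y w : X.presheaf.stalk (τ x')} (hcyw : Ideal.span ({c₀, y, w} : Set (X.presheaf.stalk (τ x'))) = maximalIdeal (X.presheaf.stalk (τ x')))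
    (h₁y : Ideal.span {(τ.stalkMap x').hom y} ≠ (maximalIdeal (X.presheaf.stalk (τ x'))).map (τ.stalkMap x').hom)
    (h₁w : Ideal.span {(τ.stalkMap x').hom w} ≠ (maximalIdeal (X.presheaf.stalk (τ x'))).map (τ.stalkMap x').hom)
    (h₂y : Ideal.span {((τ.stalkMap x'').hom.comp (X.presheaf.stalkCongr (.of_eq he.symm)).hom.hom) y} ≠
      (maximalIdeal (X.presheaf.stalk (τ x'))).map ((τ.stalkMap x'').hom.comp (X.presheaf.stalkCongr (.of_eq he.symm)).hom.hom))
    (h₂w : Ideal.span {((τ.stalkMap x'').hom.comp (X.presheaf.stalkCongr (.of_eq he.symm)).hom.hom) w} ≠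
      (maximalIdeal (X.presheaf.stalk (τ x'))).map ((τ.stalkMap x'').hom.comp (X.presheaf.stalkCongr (.of_eq he.symm)).hom.hom)) :
    x'' = x' := by
  have hψ : ((τ.stalkMap x').hom.comp (X.presheaf.stalkCongr (.of_eq (rfl : τ x' = τ x').symm)).hom.hom) = (τ.stalkMap x').hom :=
    RingHom.ext fun r => by rw [RingHom.comp_apply]; exact congrArg _ (stalkCongr_hom_apply_of_eq_self rfl r)
  refine (eq_of_nearLineCross_of_nearLineCross hτ hR hd hJ hcyw rfl he ?_ ?_ h₂y h₂w).symm
  · rw [hψ]; exact h₁y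
  · rw [hψ]; exact h₁w

end Scheme

end Summit.ResolutionOfSingularities.ResolutionOfSingularities.Theorems.RadicialJung.CleanModels

end
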